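import Summits.CriticalPhenomena.PercolationContinuityZ3.Theorems.PercNearOneGluingNoHeavyLowerTailQ44bPencilReduction
import HarnessLib

/-!
# `Q44b` for every finite weighted graph from the MIXED Bernstein coefficient (a weaker reduction)

Support file for crux `stmt-CriticalPhenomena-4575` (master-family programme, quadratic four-point row `Q44b` of
`prim-bnk-1` gen 13, OPEN for all `n`), seat `prim-l12-p6` gen 8; memo
`run/shared/lean/prim/prim-l12/FROM-prim-l12-p6-g8-Q44B-MIXED-BERNSTEIN.md`.

Along the one-bond pencil of a pair `e` the row `Q44b` is the quadratic
`(1−t)²B₀ + t(1−t)(B₀₁+B₁₀) + t²B₂` (`Q44b.row_oneBond`, seat gen 7).  The weights `(1−t)², t(1−t), t(1−t), t²`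
are nonnegative, so the row is nonnegative as soon as the two ends `B₀, B₂` AND THE MIXED COEFFICIENT
`B₀₁ + B₁₀` are (`Q44b.pencil_step_mixed`) — no concavity is needed.  Hence:

* `Q44b.row_nonneg_of_mixedAt` — if, for every weighting and every fractional pair `s(x,z)` with `x` surely
  joined to `a`, nonnegativity of the row at the two ends of the pencil implies `0 ≤ B₀₁ + B₁₀`
  (`Q44b.MIXa`), then `0 ≤ Q44b(w)` for every weighting `w` (induction on the number of fractional pairs, frozen
  cluster of `a` as the base, exactly as in `Q44b.row_nonneg_of_pencilConcave`);
* `Q44b.row_nonneg_of_mixedAny` — the same with the pencil taken along ANY fractional (non-diagonal) pair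
  (`Q44b.MIXany`): the edge may be chosen freely, in particular by its type;
* `Q44b.mixa_of_nda` — the gen-7 hypothesis `NDa` (pencil concavity, `B₀ + B₂ ≤ B₀₁ + B₁₀`) implies `MIXa`,
  so this reduction is weaker (census, memo §2: `B₀₁ + B₁₀ ≥ 0` has 0 negatives at EVERY edge type on all
  graphs with `n ≤ 6`, three weight families, 1.3 M instances, whereas concavity fails off the `a`-edges).

Definitions (`PencilMixed`, `MIXa`, `MIXany`) and theorems; no named facts, no sorries, standard axioms.
-/

noncomputable section

namespace Summit.CriticalPhenomena.PercolationContinuityZ3.Theorems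

namespace Q44b

open MeasureTheory Set Literature.Probability.LatticeModels Literature.Probability.Percolation
open scoped Classical

variable {n : ℕ}

/-- **Mixed Bernstein coefficient of the pencil along `e`, conditionally nonnegative**: if the row is
nonnegative at the two ends `w[e↦0]`, `w[e↦1]` then `0 ≤ B₀₁ + B₁₀ = bil w₀ w₁ + bil w₁ w₀`. [this work] -/
def PencilMixed (w : Sym2 (Fin n) → unitInterval) (e : Sym2 (Fin n)) (a b c y : Fin n) : Prop :=
  0 ≤ row (Function.update w e 0) a b c y → 0 ≤ row (Function.update w e 1) a b c y →
    0 ≤ bil (Function.update w e 0) (Function.update w e 1) a b c y +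
      bil (Function.update w e 1) (Function.update w e 0) a b c y

/-- **Hypothesis `MIX_a`**: for every weighting and every FRACTIONAL pair `s(x,z)` whose end `x` is surely joined
to `a` after the pair is deleted, the mixed coefficient of the pencil along `s(x,z)` is (conditionally)
nonnegative. [this work] -/
def MIXa (n : ℕ) (a b c y : Fin n) : Prop :=
  ∀ (w : Sym2 (Fin n) → unitInterval) (x z : Fin n), x ≠ z →
    sureJoined (Function.update w s(x, z) 0) a x → (w s(x, z) ≠ 0 ∧ w s(x, z) ≠ 1) →
      PencilMixed w s(x, z) a b c y

/-- **Hypothesis `MIX` at an arbitrary pair**: for every weighting and every fractional non-diagonal pair `e`,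
the mixed coefficient of the pencil along `e` is (conditionally) nonnegative. [this work] -/
def MIXany (n : ℕ) (a b c y : Fin n) : Prop :=
  ∀ (w : Sym2 (Fin n) → unitInterval) (e : Sym2 (Fin n)), ¬ e.IsDiag →
    (w e ≠ 0 ∧ w e ≠ 1) → PencilMixed w e a b c y

/-- **Pencil step, mixed form**: `(1−t)²B₀ + t(1−t)(B₀₁+B₁₀) + t²B₂ ≥ 0` on `[0,1]` as soon as
`B₀, B₂, B₀₁ + B₁₀ ≥ 0` (a nonnegative combination). [this work] -/
theorem pencil_step_mixed (w : Sym2 (Fin n) → unitInterval) (e : Sym2 (Fin n)) (a b c y : Fin n)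
    (h0 : 0 ≤ row (Function.update w e 0) a b c y) (h1 : 0 ≤ row (Function.update w e 1) a b c y)
    (hm : 0 ≤ bil (Function.update w e 0) (Function.update w e 1) a b c y +
      bil (Function.update w e 1) (Function.update w e 0) a b c y) : 0 ≤ row w a b c y := by
  rw [row_oneBond w e]
  unfold row at h0 h1
  set t : ℝ := (w e : ℝ)
  have ht0 : 0 ≤ t := unitInterval.nonneg (w e)
  have ht1 : t ≤ 1 := unitInterval.le_one (w e)
  set B0 := bil (Function.update w e 0) (Function.update w e 0) a b c y
  set B2 := bil (Function.update w e 1) (Function.update w e 1) a b c y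
  set B01 := bil (Function.update w e 0) (Function.update w e 1) a b c y
  set B10 := bil (Function.update w e 1) (Function.update w e 0) a b c y
  have e1 : (1 - t) * (1 - t) * B0 + (1 - t) * t * B01 + t * (1 - t) * B10 + t * t * B2 =
      (1 - t) * (1 - t) * B0 + t * (1 - t) * (B01 + B10) + t * t * B2 := by ring
  rw [e1]
  have h1t : 0 ≤ 1 - t := by linarith
  have hA : 0 ≤ (1 - t) * (1 - t) * B0 := mul_nonneg (mul_nonneg h1t h1t) h0
  have hB : 0 ≤ t * (1 - t) * (B01 + B10) := mul_nonneg (mul_nonneg ht0 h1t) hm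
  have hC : 0 ≤ t * t * B2 := mul_nonneg (mul_nonneg ht0 ht0) h1
  linarith

/-- Pencil concavity implies the (conditional) mixed condition: `B₀₁ + B₁₀ ≥ B₀ + B₂ ≥ 0`. [this work] -/
theorem pencilMixed_of_pencilConcave (w : Sym2 (Fin n) → unitInterval) (e : Sym2 (Fin n))
    (a b c y : Fin n) (hc : PencilConcave w e a b c y) : PencilMixed w e a b c y := by
  intro h0 h1
  unfold row at h0 h1
  unfold PencilConcave at hc
  linarith

/-- `ND_a ⇒ MIX_a`: the mixed reduction is weaker than the gen-7 concavity reduction. [this work] -/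
theorem mixa_of_nda (a b c y : Fin n) (h : NDa n a b c y) : MIXa n a b c y :=
  fun w x z hxz hsure _ => pencilMixed_of_pencilConcave w s(x, z) a b c y (h w x z hxz hsure)

/-- **The mixed reduction at `a`.**  `MIX_a` implies `0 ≤ Q44b(w)` for every weighting `w` on the pairs of
`Fin n`: induction on the number of fractional pairs; a fractional pair at `a`'s sure cluster is resolved by
`pencil_step_mixed` (the two ends have fewer fractional pairs), and when none is left the cluster of `a` is
frozen and the row vanishes (`row_eq_zero_of_frozen`). [this work] -/
theorem row_nonneg_of_mixedAt (a b c y : Fin n) (hM : MIXa n a b c y)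
    (w : Sym2 (Fin n) → unitInterval) : 0 ≤ row w a b c y := by
  suffices H : ∀ (k : ℕ) (w : Sym2 (Fin n) → unitInterval), (fracPairs w).card ≤ k → 0 ≤ row w a b c y from
    H _ w le_rfl
  intro k
  induction k with
  | zero =>
    intro w hw
    have hfro : ∀ x z : Fin n, x ≠ z → sureJoined w a x → (w s(x, z) = 0 ∨ w s(x, z) = 1) := by
      intro x z _ _
      by_contra hne
      push Not at hne
      have : s(x, z) ∈ fracPairs w := by
        simp only [fracPairs, Finset.mem_filter, Finset.mem_univ, true_and]; exact hne
      have hpos : 0 < (fracPairs w).card := Finset.card_pos.2 ⟨_, this⟩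
      omega
    exact (row_eq_zero_of_frozen w a b c y hfro).symm.le
  | succ k ih =>
    intro w hw
    by_cases hex : ∃ x z : Fin n, x ≠ z ∧ sureJoined w a x ∧ (w s(x, z) ≠ 0 ∧ w s(x, z) ≠ 1)
    · obtain ⟨x, z, hxz, hsure, hfrac⟩ := hex
      have hlt0 := Finset.card_lt_card (fracPairs_update_ssubset w hfrac 0 (Or.inl rfl))
      have hlt1 := Finset.card_lt_card (fracPairs_update_ssubset w hfrac 1 (Or.inr rfl))
      have h0 : 0 ≤ row (Function.update w s(x, z) 0) a b c y := ih _ (by omega)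
      have h1 : 0 ≤ row (Function.update w s(x, z) 1) a b c y := ih _ (by omega)
      exact pencil_step_mixed w s(x, z) a b c y h0 h1
        (hM w x z hxz (sureJoined_update_zero w hfrac.2 hsure) hfrac h0 h1)
    · push Not at hex
      have hfro : ∀ x z : Fin n, x ≠ z → sureJoined w a x → (w s(x, z) = 0 ∨ w s(x, z) = 1) := by
        intro x z hxz hs
        by_cases h0 : w s(x, z) = 0
        · exact Or.inl h0
        · exact Or.inr (hex x z hxz hs h0)
      exact (row_eq_zero_of_frozen w a b c y hfro).symm.le

/-- **The mixed reduction along an arbitrary pair.**  `MIXany` implies `0 ≤ Q44b(w)` for every weighting: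
induction on the number of fractional pairs, resolving ANY fractional non-diagonal pair by
`pencil_step_mixed`; when every non-diagonal pair has weight `0` or `1` the cluster of `a` is frozen and the
row vanishes. [this work] -/
theorem row_nonneg_of_mixedAny (a b c y : Fin n) (hM : MIXany n a b c y)
    (w : Sym2 (Fin n) → unitInterval) : 0 ≤ row w a b c y := by
  suffices H : ∀ (k : ℕ) (w : Sym2 (Fin n) → unitInterval), (fracPairs w).card ≤ k → 0 ≤ row w a b c y from
    H _ w le_rfl
  intro k
  induction k with
  | zero =>
    intro w hw
    have hfro : ∀ x z : Fin n, x ≠ z → sureJoined w a x → (w s(x, z) = 0 ∨ w s(x, z) = 1) := by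
      intro x z _ _
      by_contra hne
      push Not at hne
      have : s(x, z) ∈ fracPairs w := by
        simp only [fracPairs, Finset.mem_filter, Finset.mem_univ, true_and]; exact hne
      have hpos : 0 < (fracPairs w).card := Finset.card_pos.2 ⟨_, this⟩
      omega
    exact (row_eq_zero_of_frozen w a b c y hfro).symm.le
  | succ k ih =>
    intro w hw
    by_cases hex : ∃ x z : Fin n, x ≠ z ∧ (w s(x, z) ≠ 0 ∧ w s(x, z) ≠ 1)
    · obtain ⟨x, z, hxz, hfrac⟩ := hex
      have hlt0 := Finset.card_lt_card (fracPairs_update_ssubset w hfrac 0 (Or.inl rfl))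
      have hlt1 := Finset.card_lt_card (fracPairs_update_ssubset w hfrac 1 (Or.inr rfl))
      have h0 : 0 ≤ row (Function.update w s(x, z) 0) a b c y := ih _ (by omega)
      have h1 : 0 ≤ row (Function.update w s(x, z) 1) a b c y := ih _ (by omega)
      have hnd : ¬ (s(x, z) : Sym2 (Fin n)).IsDiag := by
        rw [Sym2.mk_isDiag_iff]; exact hxz
      exact pencil_step_mixed w s(x, z) a b c y h0 h1 (hM w s(x, z) hnd hfrac h0 h1)
    · push Not at hex
      have hfro : ∀ x z : Fin n, x ≠ z → sureJoined w a x → (w s(x, z) = 0 ∨ w s(x, z) = 1) := by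
        intro x z hxz _
        by_cases h0 : w s(x, z) = 0
        · exact Or.inl h0
        · exact Or.inr (hex x z hxz h0)
      exact (row_eq_zero_of_frozen w a b c y hfro).symm.le

end Q44b

end Summit.CriticalPhenomena.PercolationContinuityZ3.Theorems

end
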